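import Summits.QuantumFields.YangMills.Theorems.BalabanUVNodesN19KinkLowerBound
import Mathlib.Data.Nat.Log

/-!
# YM-DAG node N19 (= NE7 proper) — NO CHEAP DECOMPOSITION OF THE KINK: every splitting `|x| = Σ_p g_p + O(ε)` into polynomial pieces pays
# `Σ_p deg(g_p)·osc(g_p) ≥ (2M − 1)∕(48π)` whenever `2^M·ε ≤ 1∕(96π)` — i.e. `≳ log₂(1∕ε)∕(24π)`: the ladder's logarithm is a one-dimensional fact

Cell `pub-ymgap`, HUMAN RULING D-0062 (Track A) ∕ D-0149 (work-bound push), R141 (C) wider-strategy seat `pub-ymgap-dag-n19-e` (strategy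
s3 = ALTERNATIVE CURRENCY), generation g36, module 3 (lineage module 198).  Route `Summits/QuantumFields/YangMills/Theses/BalabanUVNodes.lean`,
cluster item K3⁸ «SpineGivenEndpointR13SepCoPHV» (stmt-QuantumFields-27366); filed `--supports` that item `--as helper` (it proves no registered
stub).  COUNT-NEUTRAL: elementary combinatorics of dyadic blocks (Abel summation, `Nat.log`) over Mathlib and, BY NAME, module 133 `…N19KinkLowerBound`
(`exists_le_abs_abs_sub_eval`: Bernstein's lower half `E_t(|x|) ≥ 1∕(π(9t+6))`); no laws, no scheme object, no Theses import; NOT a discharge claim.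

ROLE IN THE LINEAGE (HOME `numerics/OPEN-PROBLEM.md`, g34 «why no ladder gives log⁰», g36 «semiclassical reading»).  Every telescoping ladder of the
lineage writes the kink as a sum of polynomial PIECES (the dyadic increments `p_{2^{l+1}} − p_{2^l}`: degree `≍ 2^l`, oscillation `≍ 2^{−l}`, `log₂(1∕ε)`
of them) and then pays, for a character `e^{iΩ|x|}`, a Taylor ∕ Chebyshev packet of `≍ Ω·osc(piece)` terms per piece, each term of the piece's degree:
`≍ Ω·Σ_p deg(g_p)·osc(g_p)`.  THIS MODULE proves that the sum is `≳ log(1∕ε)` for EVERY decomposition, dyadic or not — the logarithm is not an artefact of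
dyadic scales but a one-dimensional fact about the kink: (§1) a dyadic counting lemma `Σ_{1≤m≤M} 2^{m−1}·[2^m ≤ d] ≤ d`; (§2) ONE LEVEL: the pieces of
degree `≥ 2^m` have total oscillation `≥ 2∕(π(9(2^m−1)+6)) − 2ε ≥ 1∕(12π·2^m) − 2ε` (the pieces of degree `< 2^m` form a polynomial of degree `≤ 2^m − 1`,
which misses `|x|` by Bernstein's lower half somewhere, while the high pieces deviate from their mid-values by at most half their total oscillation);
(§3) ★★★ `le_sum_natDegree_mul_osc` — Abel summation over `m = 1 … M`: **`(2M − 1)∕(48π) ≤ Σ_p deg(g_p)·(hi_p − lo_p)`** for any family of polynomials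
`g_p` with `lo_p ≤ g_p ≤ hi_p` on `[−1,1]` and `||x| − Σ_p g_p(x)| ≤ ε` on `[−1,1]`, as soon as `2^M·ε ≤ 1∕(96π)`.  With `M = ⌊log₂(1∕(96πε))⌋` this is
`≥ (log₂(1∕ε) − 10)∕(24π)`.  The dyadic ladder (`Σ ≍ log₂(1∕ε)`) is therefore optimal up to a constant among ALL decompositions.
CONSEQUENCE (paper, semiclassical): in the packet accounting of the g36 addendum the weighted cost of `e^{iΩ·ℓ(ν)}` is `Ω·Σ_p deg(g_p)·osc(g_p)∕2` divided by
the ENDPOINT ENHANCEMENT factors of the pieces at `ν`; without enhancement every ridge-packet synthesis pays `≳ Ω·log(1∕ε)`, and the only way below the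
logarithm inside that class is enhancement (one-sided pieces whose means sit at the end of their ranges) — `√log` in the simplex model, conjecturally.

HONEST FRAMING (binding).  Elementary and [folklore]-style (a counting argument over Bernstein 1914); constants crude (`1∕(24π)` per dyadic level against
the dyadic ladder's `≈ 0.28·(1∕2)`); NO consumer in the DAG today (a structural remark on the seat's own upper-bound methods); nothing of Bałaban's
instantiated; NE7 NOT PRINTED, NOT proved; N19 NOT discharged; count-neutral.  One finite `T⁴` programme at fixed `ε`; nothing continuum ∕ `ℝ⁴` ∕ OS ∕
mass-gap ∕ Clay.  0 `def` ∕ 0 `sorry`.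
-/

noncomputable section

open Finset Polynomial
open scoped Real

namespace Summit.QuantumFields.YangMills.Theorems.BalabanUVNodesN19NoCheapDecomposition

open Summit.QuantumFields.YangMills.Theorems.BalabanUVNodesN19KinkLowerBound (exists_le_abs_abs_sub_eval)

/-! ## §1 Dyadic counting [bookkeeping] -/

/-- `Σ_{1 ≤ m ≤ M, 2^m ≤ d} 2^{m−1} ≤ d`: the admissible `m` are `≤ log₂ d`, and `Σ_{m ≤ λ} 2^{m−1} = 2^λ − 1 ≤ d`. [bookkeeping] -/
theorem sum_ite_two_pow_le (d M : ℕ) :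
    ∑ m ∈ Ico 1 (M + 1), (if 2 ^ m ≤ d then (2 : ℝ) ^ (m - 1) else 0) ≤ d := by
  rcases Nat.eq_zero_or_pos d with hd | hd
  · subst hd
    have : ∀ m ∈ Ico 1 (M + 1), (if 2 ^ m ≤ 0 then (2 : ℝ) ^ (m - 1) else 0) = 0 := fun m _ => by
      rw [if_neg]; exact Nat.not_le.2 (pow_pos two_pos m)
    rw [Finset.sum_congr rfl this, Finset.sum_const_zero]; simp
  rw [← Finset.sum_filter]
  set lam := Nat.log 2 d with hlam
  calc ∑ m ∈ (Ico 1 (M + 1)).filter (fun m => 2 ^ m ≤ d), (2 : ℝ) ^ (m - 1)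
      ≤ ∑ m ∈ Ico 1 (lam + 1), (2 : ℝ) ^ (m - 1) := by
        refine Finset.sum_le_sum_of_subset_of_nonneg (fun m hm => ?_) fun m _ _ => by positivity
        simp only [Finset.mem_filter, Finset.mem_Ico] at hm ⊢
        exact ⟨hm.1.1, Nat.lt_succ_of_le (Nat.le_log_of_pow_le one_lt_two hm.2)⟩
    _ = ∑ j ∈ range lam, (2 : ℝ) ^ j := by
        rw [Finset.sum_Ico_eq_sum_range]
        refine Finset.sum_congr (by simp) fun j _ => ?_
        congr 1; omega
    _ = 2 ^ lam - 1 := by rw [geom_sum_eq (by norm_num) lam]; norm_num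
    _ ≤ d := by
        have h : ((2 ^ lam : ℕ) : ℝ) ≤ d := by exact_mod_cast Nat.pow_log_le_self 2 hd.ne'
        push_cast at h; linarith

/-! ## §2 One dyadic level: the high pieces carry Bernstein's lower half [folklore] -/

/-- **ONE LEVEL.**  Let `g_p` (`p ∈ s`) be real polynomials with `lo_p ≤ g_p(x) ≤ hi_p` on `[−1,1]` and `||x| − Σ_p g_p(x)| ≤ ε` on `[−1,1]`, and let
`m ≥ 1`.  Then the pieces of degree `≥ 2^m` have total oscillation `Σ_{deg g_p ≥ 2^m}(hi_p − lo_p) ≥ 1∕(12π·2^m) − 2ε`: the other pieces plus the mid-value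
constant `Σ(hi_p + lo_p)∕2` form a polynomial of degree `≤ 2^m − 1`, which misses `|x|` by `≥ 1∕(π(9(2^m−1)+6)) ≥ 1∕(12π·2^m)` somewhere (module 133),
while there the high pieces deviate from their mid-values by at most half the total oscillation. [folklore] -/
theorem le_sum_osc_highPieces {κ : Type*} (s : Finset κ) (g : κ → ℝ[X]) (lo hi : κ → ℝ) {ε : ℝ}
    (hbd : ∀ p ∈ s, ∀ x : ℝ, x ∈ Set.Icc (-1 : ℝ) 1 → lo p ≤ (g p).eval x ∧ (g p).eval x ≤ hi p)
    (happ : ∀ x : ℝ, x ∈ Set.Icc (-1 : ℝ) 1 → |(|x|) - ∑ p ∈ s, (g p).eval x| ≤ ε) {m : ℕ} (hm : 1 ≤ m) :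
    1 / (12 * π * 2 ^ m) - 2 * ε ≤ ∑ p ∈ s.filter (fun p => 2 ^ m ≤ (g p).natDegree), (hi p - lo p) := by
  classical
  have hπ := Real.pi_pos
  set I := s.filter (fun p => 2 ^ m ≤ (g p).natDegree) with hI
  set Lw := s.filter (fun p => ¬ 2 ^ m ≤ (g p).natDegree) with hLw
  set c : ℝ := ∑ p ∈ I, (hi p + lo p) / 2 with hc
  set Q : ℝ[X] := (∑ p ∈ Lw, g p) + Polynomial.C c with hQ
  have h2m : 2 ≤ 2 ^ m := by
    calc 2 = 2 ^ 1 := by norm_num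
      _ ≤ 2 ^ m := Nat.pow_le_pow_right two_pos hm
  have hQdeg : Q.natDegree ≤ 2 ^ m - 1 := by
    refine (Polynomial.natDegree_add_le _ _).trans (max_le ?_ ?_)
    · refine Polynomial.natDegree_sum_le_of_forall_le _ _ fun p hp => ?_
      simp only [hLw, Finset.mem_filter] at hp
      omega
    · rw [Polynomial.natDegree_C]; exact Nat.zero_le _
  obtain ⟨x, hx, hB⟩ := exists_le_abs_abs_sub_eval (t := 2 ^ m - 1) (by omega) Q hQdeg
  -- the decomposition at `x`
  have hsplit : ∑ p ∈ s, (g p).eval x = (∑ p ∈ I, (g p).eval x) + ∑ p ∈ Lw, (g p).eval x := by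
    rw [hI, hLw, Finset.sum_filter_add_sum_filter_not]
  have hQev : Q.eval x = (∑ p ∈ Lw, (g p).eval x) + c := by
    rw [hQ, Polynomial.eval_add, Polynomial.eval_finsetSum, Polynomial.eval_C]
  have hkey : (|x|) - Q.eval x = ((|x|) - ∑ p ∈ s, (g p).eval x) + ∑ p ∈ I, ((g p).eval x - (hi p + lo p) / 2) := by
    rw [hQev, hsplit, hc, Finset.sum_sub_distrib]; ring
  have hhigh : |∑ p ∈ I, ((g p).eval x - (hi p + lo p) / 2)| ≤ ∑ p ∈ I, (hi p - lo p) / 2 := by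
    refine (Finset.abs_sum_le_sum_abs _ _).trans (Finset.sum_le_sum fun p hp => ?_)
    have hps : p ∈ s := (Finset.mem_filter.1 hp).1
    obtain ⟨h1, h2⟩ := hbd p hps x hx
    rw [abs_le]; constructor <;> linarith
  have hlow : 1 / (12 * π * 2 ^ m) ≤ 1 / (π * (9 * ((2 ^ m - 1 : ℕ) : ℝ) + 6)) := by
    have hcast : ((2 ^ m - 1 : ℕ) : ℝ) = (2 : ℝ) ^ m - 1 := by
      rw [Nat.cast_sub (by omega)]; push_cast; ring
    rw [hcast]
    have h2 : (2 : ℝ) ≤ 2 ^ m := by exact_mod_cast h2m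
    exact one_div_le_one_div_of_le (mul_pos hπ (by linarith)) (by nlinarith [hπ, h2])
  have hpos' : 0 ≤ 1 / (12 * π * 2 ^ m) := by positivity
  have := calc 1 / (12 * π * 2 ^ m) ≤ |(|x|) - Q.eval x| := hlow.trans hB
    _ ≤ |(|x|) - ∑ p ∈ s, (g p).eval x| + |∑ p ∈ I, ((g p).eval x - (hi p + lo p) / 2)| := by rw [hkey]; exact abs_add_le _ _
    _ ≤ ε + ∑ p ∈ I, (hi p - lo p) / 2 := add_le_add (happ x hx) hhigh
  have e : ∑ p ∈ I, (hi p - lo p) / 2 = (∑ p ∈ I, (hi p - lo p)) / 2 := by rw [Finset.sum_div]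
  rw [e] at this
  linarith

/-! ## §3 ★★★ No cheap decomposition [folklore] -/

/-- ★★★ **NO CHEAP DECOMPOSITION OF THE KINK.**  Let `g_p` (`p ∈ s`) be real polynomials with `lo_p ≤ g_p(x) ≤ hi_p` on `[−1,1]` and
`||x| − Σ_p g_p(x)| ≤ ε` on `[−1,1]`.  Then for every `M` with `2^M·ε ≤ 1∕(96π)`:
**`(2M − 1)∕(48π) ≤ Σ_p deg(g_p)·(hi_p − lo_p)`.**  (Abel summation: `Σ_p deg(g_p)·osc_p ≥ Σ_{m=1}^{M} 2^{m−1}·Σ_{deg g_p ≥ 2^m} osc_p ≥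
Σ_{m=1}^{M}(1∕(24π) − 2^mε) ≥ M∕(24π) − 2^{M+1}ε`.)  With `M = ⌊log₂(1∕(96πε))⌋`: `≥ (log₂(1∕ε) − 10)∕(24π)`; the dyadic ladder's pieces give
`Σ ≍ log₂(1∕ε)` — optimal up to a constant among ALL decompositions. [folklore] -/
theorem le_sum_natDegree_mul_osc {κ : Type*} (s : Finset κ) (g : κ → ℝ[X]) (lo hi : κ → ℝ) {ε : ℝ}
    (hbd : ∀ p ∈ s, ∀ x : ℝ, x ∈ Set.Icc (-1 : ℝ) 1 → lo p ≤ (g p).eval x ∧ (g p).eval x ≤ hi p)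
    (happ : ∀ x : ℝ, x ∈ Set.Icc (-1 : ℝ) 1 → |(|x|) - ∑ p ∈ s, (g p).eval x| ≤ ε)
    {M : ℕ} (hM : (2 : ℝ) ^ M * ε ≤ 1 / (96 * π)) :
    (2 * M - 1) / (48 * π) ≤ ∑ p ∈ s, ((g p).natDegree : ℝ) * (hi p - lo p) := by
  classical
  have hπ := Real.pi_pos
  have hw : ∀ p ∈ s, 0 ≤ hi p - lo p := fun p hp => by
    obtain ⟨h1, h2⟩ := hbd p hp 0 (by norm_num); linarith
  -- Abel summation: the weighted sum dominates the dyadic tail sums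
  have hAbel : ∑ m ∈ Ico 1 (M + 1), (2 : ℝ) ^ (m - 1) * ∑ p ∈ s.filter (fun p => 2 ^ m ≤ (g p).natDegree), (hi p - lo p) ≤
      ∑ p ∈ s, ((g p).natDegree : ℝ) * (hi p - lo p) := by
    have e : ∀ m : ℕ, (2 : ℝ) ^ (m - 1) * ∑ p ∈ s.filter (fun p => 2 ^ m ≤ (g p).natDegree), (hi p - lo p) =
        ∑ p ∈ s, (if 2 ^ m ≤ (g p).natDegree then (2 : ℝ) ^ (m - 1) else 0) * (hi p - lo p) := fun m => by
      rw [Finset.sum_filter, Finset.mul_sum]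
      refine Finset.sum_congr rfl fun p _ => ?_
      split_ifs <;> simp
    rw [Finset.sum_congr rfl fun m _ => e m, Finset.sum_comm]
    refine Finset.sum_le_sum fun p hp => ?_
    rw [← Finset.sum_mul]
    exact mul_le_mul_of_nonneg_right (sum_ite_two_pow_le _ _) (hw p hp)
  -- each level contributes at least `1/(24π) − 2^m ε`
  have hlev : ∀ m ∈ Ico 1 (M + 1), 1 / (24 * π) - (2 : ℝ) ^ m * ε ≤
      (2 : ℝ) ^ (m - 1) * ∑ p ∈ s.filter (fun p => 2 ^ m ≤ (g p).natDegree), (hi p - lo p) := by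
    intro m hm
    have hm1 : 1 ≤ m := (Finset.mem_Ico.1 hm).1
    have h := le_sum_osc_highPieces s g lo hi hbd happ hm1
    have h2 : (0 : ℝ) < 2 ^ (m - 1) := by positivity
    have e : (2 : ℝ) ^ m = 2 * 2 ^ (m - 1) := by
      rw [← pow_succ']; congr 1; omega
    have h3 := mul_le_mul_of_nonneg_left h h2.le
    rw [e] at h3 ⊢
    have e2 : (2 : ℝ) ^ (m - 1) * (1 / (12 * π * (2 * 2 ^ (m - 1))) - 2 * ε) = 1 / (24 * π) - 2 * 2 ^ (m - 1) * ε := by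
      field_simp; ring
    rw [e2] at h3
    exact h3
  -- sum the levels
  have hsum : ∑ m ∈ Ico 1 (M + 1), (1 / (24 * π) - (2 : ℝ) ^ m * ε) = M * (1 / (24 * π)) - ε * ∑ m ∈ Ico 1 (M + 1), (2 : ℝ) ^ m := by
    rw [Finset.sum_sub_distrib, Finset.sum_const, Nat.card_Ico, nsmul_eq_mul, Finset.mul_sum]
    simp only [add_tsub_cancel_right]
    congr 1
    exact Finset.sum_congr rfl fun m _ => by ring
  have hgeom : ∑ m ∈ Ico 1 (M + 1), (2 : ℝ) ^ m ≤ 2 ^ (M + 1) := by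
    calc ∑ m ∈ Ico 1 (M + 1), (2 : ℝ) ^ m ≤ ∑ m ∈ range (M + 1), (2 : ℝ) ^ m :=
          Finset.sum_le_sum_of_subset_of_nonneg (fun m hm => by
            simp only [Finset.mem_Ico, Finset.mem_range] at hm ⊢; exact hm.2) fun _ _ _ => by positivity
      _ = 2 ^ (M + 1) - 1 := by rw [geom_sum_eq (by norm_num) (M + 1)]; norm_num
      _ ≤ 2 ^ (M + 1) := by linarith
  have hε : 0 ≤ ε := le_trans (abs_nonneg _) (happ 0 (by norm_num))
  have htot := calc (M : ℝ) * (1 / (24 * π)) - ε * 2 ^ (M + 1)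
      ≤ M * (1 / (24 * π)) - ε * ∑ m ∈ Ico 1 (M + 1), (2 : ℝ) ^ m := by nlinarith [hgeom, hε]
    _ = ∑ m ∈ Ico 1 (M + 1), (1 / (24 * π) - (2 : ℝ) ^ m * ε) := hsum.symm
    _ ≤ ∑ m ∈ Ico 1 (M + 1), (2 : ℝ) ^ (m - 1) * ∑ p ∈ s.filter (fun p => 2 ^ m ≤ (g p).natDegree), (hi p - lo p) :=
        Finset.sum_le_sum hlev
    _ ≤ ∑ p ∈ s, ((g p).natDegree : ℝ) * (hi p - lo p) := hAbel
  have h48 : ε * 2 ^ (M + 1) ≤ 1 / (48 * π) := by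
    rw [pow_succ]
    calc ε * (2 ^ M * 2) = 2 * (2 ^ M * ε) := by ring
      _ ≤ 2 * (1 / (96 * π)) := by linarith
      _ = 1 / (48 * π) := by field_simp; ring
  have e : (2 * (M : ℝ) - 1) / (48 * π) = M * (1 / (24 * π)) - 1 / (48 * π) := by field_simp; ring
  rw [e]; linarith

/-- ★ **THE SAME IN LOGARITHMIC FORM**: if `0 < ε` and `log₂(1∕(96πε)) ≥ 0`, then with `M = ⌊log₂(1∕(96πε))⌋`:
`Σ_p deg(g_p)·(hi_p − lo_p) ≥ (2⌊log₂(1∕(96πε))⌋ − 1)∕(48π)` (`≥ (log₂(1∕ε) − 10)∕(24π)`). [folklore] -/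
theorem le_sum_natDegree_mul_osc_log {κ : Type*} (s : Finset κ) (g : κ → ℝ[X]) (lo hi : κ → ℝ) {ε : ℝ} (hε : 0 < ε)
    (hbd : ∀ p ∈ s, ∀ x : ℝ, x ∈ Set.Icc (-1 : ℝ) 1 → lo p ≤ (g p).eval x ∧ (g p).eval x ≤ hi p)
    (happ : ∀ x : ℝ, x ∈ Set.Icc (-1 : ℝ) 1 → |(|x|) - ∑ p ∈ s, (g p).eval x| ≤ ε)
    (hlog : 0 ≤ Real.logb 2 (1 / (96 * π * ε))) :
    (2 * (⌊Real.logb 2 (1 / (96 * π * ε))⌋₊ : ℝ) - 1) / (48 * π) ≤ ∑ p ∈ s, ((g p).natDegree : ℝ) * (hi p - lo p) := by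
  have hπ := Real.pi_pos
  set M : ℕ := ⌊Real.logb 2 (1 / (96 * π * ε))⌋₊ with hM
  refine le_sum_natDegree_mul_osc s g lo hi hbd happ (M := M) ?_
  have hMle : (M : ℝ) ≤ Real.logb 2 (1 / (96 * π * ε)) := Nat.floor_le hlog
  have h2M : (2 : ℝ) ^ M ≤ 1 / (96 * π * ε) := by
    have h := Real.rpow_le_rpow_of_exponent_le (show (1 : ℝ) ≤ 2 by norm_num) hMle
    rw [Real.rpow_natCast, Real.rpow_logb (by norm_num) (by norm_num) (by positivity)] at h
    exact h
  calc (2 : ℝ) ^ M * ε ≤ 1 / (96 * π * ε) * ε := mul_le_mul_of_nonneg_right h2M hε.le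
    _ = 1 / (96 * π) := by field_simp

end Summit.QuantumFields.YangMills.Theorems.BalabanUVNodesN19NoCheapDecomposition

end
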